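import Summits.QuantumAdvantage.QuantumAdvantage.Theses.MobiusLadder
import Summits.QuantumAdvantage.QuantumAdvantage.Theorems.MobiusLadderLiouvilleNotTC0

/-!
# Route `MobiusLadder`, item `LiouvilleNotAC0` (stmt-QuantumAdvantage-1396)

The class glue of rung R0 of route `QuantumAdvantage/MobiusLadder`:
`LiouvilleOrthogonalAC0 → L_λ ∉ AC⁰`, where
`L_λ = encodingNatBool.toLanguage {N | λ N = -1}` (canonical LSB-first binary numerals,
`Computability.encodeNat`) and `LiouvilleOrthogonalAC0` is Möbius randomness of the Liouville
function `λ` against constant-depth polynomial-size circuits over `acBasis`.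

The argument is basis-independent and already in the tree as
`Summit.QuantumAdvantage.QuantumAdvantage.Theorems.MobiusLadder.liouvilleLang_not_mem_depthSizeClass`
(file `MobiusLadderLiouvilleNotTC0.lean`, the TC⁰ twin `LiouvilleNotTC0`): a family deciding
`L_λ`, evaluated at length `n` on the digits of `N < 2^n`, outputs `[2^(n-1) ≤ N ∧ λ N = -1]`
(inputs with top bit `0` are not codewords), so its correlation with `λ` is
`2^(n-1) + ∑_{N<2^(n-1)} λ(N) ≥ 2^(n-2)` by the elementary cancellation `λ(2m) = -λ(m)`
(no prime number theorem), contradicting orthogonality at `ε = 1/8`. This file specialises it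
to `acBasis`; nothing else is needed (`AC0` is literally `∃ d p, L ∈ DepthSizeClass acBasis d p`).

Sources: B. Green, *On (not) computing the Möbius function using bounded depth circuits*,
Combin. Probab. Comput. 21 (2012), §1; S. Arora, B. Barak, *Computational Complexity* (2009),
§14.1 (AC⁰), Def. 6.2 (families deciding a language).
-/

set_option linter.dupNamespace false -- D-0017: single-problem summit ⇒ `QuantumAdvantage.QuantumAdvantage` by design

namespace Summit.QuantumAdvantage.QuantumAdvantage.Theorems.MobiusLadder

open Literature.Computability.Complexity

/-- Settles `stmt-QuantumAdvantage-1396` (route MobiusLadder, support `LiouvilleNotAC0`):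
Möbius randomness of `λ` for `AC⁰` (`LiouvilleOrthogonalAC0`) implies that the Liouville
language `L_λ = {bin(N) : λ(N) = -1}` is not in `AC⁰` — the basis-generic glue
`liouvilleLang_not_mem_depthSizeClass` (a deciding family has correlation
`2^(n-1) + ∑_{N<2^(n-1)} λ(N) ≥ 2^(n-2)` with `λ`, by `λ(2m) = -λ(m)`; contradiction at
`ε = 1/8`) at the basis `acBasis` (Arora–Barak 2009, §14.1 for the class; Green 2012, §1 for
the set-up). Elementary; no PNT. [cite: Green2012, §1] [cite: AroraBarakCC2009, §14.1] -/
theorem LiouvilleNotAC0_proof :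
    Summit.QuantumAdvantage.QuantumAdvantage.Theses.MobiusLadder.LiouvilleNotAC0 := by
  unfold Summit.QuantumAdvantage.QuantumAdvantage.Theses.MobiusLadder.LiouvilleNotAC0
    Summit.QuantumAdvantage.QuantumAdvantage.Theses.MobiusLadder.LiouvilleOrthogonalAC0
  intro H hL
  obtain ⟨d, p, hmem⟩ := hL
  exact liouvilleLang_not_mem_depthSizeClass acBasis H d p hmem

end Summit.QuantumAdvantage.QuantumAdvantage.Theorems.MobiusLadder
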